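import Literature.NumberTheory.Transcendental.CurvePeriodsProofs
import Mathlib.RingTheory.Algebraic.Integral
import HarnessLib

/-!
# Periods of curve type: the affine-line case of Huber–Wüstholz, Theorem 13.3 (2)

Companion of `Literature/NumberTheory/Transcendental/CurvePeriods.lean`. The named fact
`HuberWustholzCurvePeriods` (Huber–Wüstholz 2022, Thm. 13.3 (2), rendered on explicit period
symbols) is far beyond Mathlib; this file proves its **toy special case** in which every symbol of
the combination lives on the affine line `𝔸¹` itself (`CurveData.affineLine`): there every
polynomial 1-form `G(x) dx` is exact, `G dx = dP`, so by the exactness relation (R3) each symbol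
is equivalent to `(P(γ(1)) − P(γ(0))) · 𝟙`, and a vanishing combination reduces to
`(Σ c_s ∫_{γ_s} ω_s) · 𝟙 = 0 · 𝟙` (book, proof of Lemma 12.4: the periods of `H¹(𝔸¹, D)` are
algebraic). This is the mechanism of the general theorem in the one case where no transcendence
input is needed; already `𝔸¹ ∖ {points}` would contain Baker's theorem.

## Main statements (all proved)

* `HasAlgCoeffs.isAlgebraic_eval` — a polynomial over `ℚ̄` takes algebraic values at algebraic
  points;
* `exists_antiderivative` — a polynomial in one variable over `ℚ̄` has an antiderivative over `ℚ̄`;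
* `exists_rel_of_affineLine` — a symbol on `𝔸¹` is (R3)-equivalent to an algebraic multiple of
  the unit symbol;
* `huberWustholzCurvePeriods_of_affineLine` — `HuberWustholzCurvePeriods` for combinations
  supported on symbols with `Z = 𝔸¹`.

## References

* A. Huber, G. Wüstholz, *Transcendence and Linear Relations of 1-Periods*, Cambridge Tracts in
  Mathematics 227, CUP 2022 [HuberWustholz2022], Lemma 12.4 (p. 114 of the held text),
  Thm. 13.3 (2) (p. 121).
-/

noncomputable section

open scoped BigOperators
open MvPolynomial Set

namespace Literature.NumberTheory.Transcendental

namespace CurvePeriods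

/-! ### Algebraic values and antiderivatives -/

/-- A finite sum of algebraic numbers is algebraic. [folklore] -/
theorem isAlgebraic_finsetSum {ι : Type*} (s : Finset ι) (f : ι → ℂ)
    (hf : ∀ i ∈ s, IsAlgebraic ℚ (f i)) : IsAlgebraic ℚ (∑ i ∈ s, f i) :=
  Finset.sum_induction f (IsAlgebraic ℚ) (fun _ _ ha hb => ha.add hb) isAlgebraic_zero hf

/-- A finite product of algebraic numbers is algebraic. [folklore] -/
theorem isAlgebraic_finsetProd {ι : Type*} (s : Finset ι) (f : ι → ℂ)
    (hf : ∀ i ∈ s, IsAlgebraic ℚ (f i)) : IsAlgebraic ℚ (∏ i ∈ s, f i) :=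
  Finset.prod_induction f (IsAlgebraic ℚ) (fun _ _ ha hb => ha.mul hb) isAlgebraic_one hf

/-- **A polynomial with algebraic coefficients takes algebraic values at algebraic points.**
[folklore] -/
theorem HasAlgCoeffs.isAlgebraic_eval {n : ℕ} {P : MvPolynomial (Fin n) ℂ} (hP : HasAlgCoeffs P)
    {z : Fin n → ℂ} (hz : ∀ i, IsAlgebraic ℚ (z i)) : IsAlgebraic ℚ (eval z P) := by
  rw [eval_eq']
  exact isAlgebraic_finsetSum _ _ fun d _ =>
    (hP d).mul (isAlgebraic_finsetProd _ _ fun i _ => (hz i).pow _)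

/-- **Antiderivatives over `ℚ̄`**: a polynomial `G` in one variable with algebraic coefficients is
the derivative of a polynomial `P` with algebraic coefficients. [folklore] -/
theorem exists_antiderivative (G : MvPolynomial (Fin 1) ℂ) (hG : HasAlgCoeffs G) :
    ∃ P : MvPolynomial (Fin 1) ℂ, HasAlgCoeffs P ∧ pderiv 0 P = G := by
  classical
  refine ⟨∑ d ∈ G.support, monomial (d + Finsupp.single 0 1) (coeff d G / ((d 0 : ℂ) + 1)),
    ?_, ?_⟩
  · intro e
    rw [coeff_sum]
    refine isAlgebraic_finsetSum _ _ fun d _ => ?_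
    rw [coeff_monomial]
    split_ifs
    · rw [div_eq_mul_inv]
      refine (hG d).mul (IsAlgebraic.inv ?_)
      exact_mod_cast isAlgebraic_nat (R := ℚ) (A := ℂ) (d 0 + 1)
    · exact isAlgebraic_zero
  · rw [map_sum]
    conv_rhs => rw [← support_sum_monomial_coeff G]
    refine Finset.sum_congr rfl fun d _ => ?_
    rw [pderiv_monomial, add_tsub_cancel_right]
    congr 1
    rw [Finsupp.add_apply, Finsupp.single_eq_same, Nat.cast_add, Nat.cast_one]
    field_simp

/-! ### Symbols on the affine line -/

/-- **A symbol on `𝔸¹` is (R3)-equivalent to an algebraic multiple of the unit symbol**: for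
`s = (𝔸¹, G dx, γ)` and `dP = G dx`, `s − (P(γ(1)) − P(γ(0))) · 𝟙` is the exactness relation
(R3), `P(γ(1)) − P(γ(0))` is algebraic and equals `∫_γ G dx` (book, proof of Lemma 12.4).
[cite: HuberWustholz2022, Lemma 12.4 (p. 114)] -/
theorem exists_rel_of_affineLine (s : PeriodSymbol) (hs : s.Z = CurveData.affineLine) :
    ∃ π : ℂ, IsAlgebraic ℚ π ∧ s.period = π ∧
      IsElementaryRelation (Finsupp.single s 1 - π • Finsupp.single PeriodSymbol.unit 1) := by
  obtain ⟨Z, hZ, ω, hω, γ⟩ := s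
  dsimp only at hs
  subst hs
  obtain ⟨P, hPalg, hPd⟩ := exists_antiderivative (ω 0) (hω 0)
  have hωP : ω = formD P := by
    funext i
    have hi : i = 0 := Subsingleton.elim i 0
    subst hi
    rw [formD, hPd]
  subst hωP
  refine ⟨eval (γ.toFun 1) P - eval (γ.toFun 0) P, ?_, period_formD _ hZ γ P hω,
    IsElementaryRelation.exact _ hZ γ P hPalg (formD P) hω rfl⟩
  exact (hPalg.isAlgebraic_eval γ.algebraic_one).sub (hPalg.isAlgebraic_eval γ.algebraic_zero)

/-- **Huber–Wüstholz, Theorem 13.3 (2), on the affine line** (toy case of the named fact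
`HuberWustholzCurvePeriods`, proved): a vanishing `ℚ̄`-linear combination of period symbols all
of whose curves are `𝔸¹` is a `ℚ̄`-linear combination of elementary relations — indeed of the
exactness relations (R3) of its own symbols, with the same coefficients.
[cite: HuberWustholz2022, Thm. 13.3 (2) (p. 121), Lemma 12.4 (p. 114)] -/
theorem huberWustholzCurvePeriods_of_affineLine (c : PeriodSymbol →₀ ℂ)
    (hc : ∀ s, IsAlgebraic ℚ (c s)) (hsupp : ∀ s ∈ c.support, s.Z = CurveData.affineLine)
    (h0 : evalCombination c = 0) :
    ∃ (k : ℕ) (ρ : Fin k → (PeriodSymbol →₀ ℂ)) (a : Fin k → ℂ),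
      (∀ l, IsElementaryRelation (ρ l)) ∧ (∀ l, IsAlgebraic ℚ (a l)) ∧ c = ∑ l, a l • ρ l := by
  classical
  have key : ∀ s : PeriodSymbol, ∃ π : ℂ, s ∈ c.support → (IsAlgebraic ℚ π ∧ s.period = π ∧
      IsElementaryRelation (Finsupp.single s 1 - π • Finsupp.single PeriodSymbol.unit 1)) := by
    intro s
    by_cases hs : s ∈ c.support
    · obtain ⟨π, h₁, h₂, h₃⟩ := exists_rel_of_affineLine s (hsupp s hs)
      exact ⟨π, fun _ => ⟨h₁, h₂, h₃⟩⟩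
    · exact ⟨0, fun h => (hs h).elim⟩
  choose π hπ using key
  -- `c = Σ_s c_s · s`
  have hc_eq : c = ∑ s ∈ c.support, c s • Finsupp.single s 1 := by
    conv_lhs => rw [← Finsupp.sum_single c]
    simp only [Finsupp.sum, Finsupp.smul_single_one]
  -- `Σ_s c_s π_s = ev c = 0`
  have hev : ∑ s ∈ c.support, c s * π s = 0 := by
    rw [← h0, evalCombination, Finsupp.sum]
    exact Finset.sum_congr rfl fun s hs => by rw [(hπ s hs).2.1]
  -- hence `c = Σ_s c_s · (s − π_s 𝟙)`
  have hdec : c = ∑ s ∈ c.support,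
      c s • (Finsupp.single s (1 : ℂ) - π s • Finsupp.single PeriodSymbol.unit (1 : ℂ)) := by
    have hsplit : ∑ s ∈ c.support,
        c s • (Finsupp.single s (1 : ℂ) - π s • Finsupp.single PeriodSymbol.unit (1 : ℂ)) =
        ∑ s ∈ c.support, c s • Finsupp.single s (1 : ℂ) -
          (∑ s ∈ c.support, c s * π s) • Finsupp.single PeriodSymbol.unit (1 : ℂ) := by
      rw [Finset.sum_smul, ← Finset.sum_sub_distrib]
      exact Finset.sum_congr rfl fun s _ => by rw [smul_sub, smul_smul]
    rw [hsplit, hev, zero_smul, sub_zero]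
    exact hc_eq
  -- reindex by `Fin k`
  refine ⟨c.support.card,
    fun l => Finsupp.single (c.support.equivFin.symm l).1 (1 : ℂ) -
      π (c.support.equivFin.symm l).1 • Finsupp.single PeriodSymbol.unit (1 : ℂ),
    fun l => c (c.support.equivFin.symm l).1, fun l => (hπ _ (c.support.equivFin.symm l).2).2.2,
    fun l => hc _, ?_⟩
  conv_lhs => rw [hdec, ← Finset.sum_coe_sort]
  refine Fintype.sum_equiv c.support.equivFin _ _ fun s => ?_
  simp only [Equiv.symm_apply_apply]

end CurvePeriods

end Literature.NumberTheory.Transcendental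

end
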